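import Literature.NumberTheory.Automorphic.GL2AdelicWeightVectors
import Literature.NumberTheory.Automorphic.NewformAdelisationDescentHolomorphy
import Literature.NumberTheory.Automorphic.NewformAdelisationHeckeOperator
import Literature.NumberTheory.Automorphic.AutomorphicRepsGLCuspFormsSquareIntegrable
import HarnessLib

/-!
# The descent of a weight-one vector: `ψ ↦ f_ψ ∈ S₁(Γ₁(N))` with `φ_{f_ψ} = ψ`
(Gelbart 1997, Prop. 2.5, converse direction, weight one)

Topic `NumberTheory/Automorphic`; a brick of the dictionary `π ↦ f_π` (hypothesis `hdesc` of
`StrongArtinGL2WeightOneDictionary`). Given a cusp form `ψ` on `GL₂(𝔸_ℚ)` (an element of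
`cuspFormsGL 2 ℚ hcpt`) which is right invariant under `{1} × K₁(N)`, of `SO(2)`-weight one along
`ι_𝔸 : GL₂(ℝ) → GL₂(𝔸_ℚ)`, killed by the lowering operator `X` and by `Z = 1 ∈ 𝔤𝔩₂(ℝ)`, this file
produces the classical cusp form `f_ψ ∈ S₁(Γ₁(N))` with `φ_{f_ψ} = ψ`
(`exists_cuspForm_one_lift_eq`, stated with the typed alias `adelicLiftFunA` of
`NewformAdelisationHeckeOperator`): the hypotheses (i)–(v) of `adelicDescentCuspForm` of
`NewformAdelisationDescentHolomorphy` are read off — left invariance and archimedean smoothness from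
`IsAutomorphicForm`, the weight from `GL2Real.hasArchWeight_one_of_isWeightVec` (`Z ψ = 0` gives the
invariance under positive scalars), the annihilation by `X` from
`GL2Real.lowering_eq_zero_of_lowerFun_eq_zero`, and boundedness from the boundedness of
`A_G`-invariant cusp forms (`AutomorphicRepsGL.cuspidal_bounded`, a hypothesis here, discharged in
the tree by `AutomorphicRepsGL.cuspidal_bounded_holds` of `CuspFormsBoundedHC`; the `A_G`-invariance is
again `Z ψ = 0`, `GL2Real.apply_mul_realScalarGL_of_lieDeriv_one`).

Also: `adelicLiftFun` is linear in `f` (`adelicLiftFun_add/smul/sub`) and injective on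
`Γ₁(N)`-invariant forms (`adelicLiftFun_injective`), so that operator identities on the lifts
descend to the classical forms (`eq_smul_of_adelicLiftFun_eq_smul`).

Everything is proved; no definitions.

## References

* S. Gelbart, *Three lectures on the modularity of `ρ̄_{E,3}` and the Langlands reciprocity
  conjecture* (1997), Prop. 2.5 and Remark 2.5.5 [Gelbart1997].
* S. Gelbart, *Automorphic forms on adele groups* (1975), §3.A, Prop. 3.1 [Gelbart1975].
* D. Bump, *Automorphic forms and representations* (1997), §3.2, §3.6 [Bump1997].
-/

noncomputable section

open scoped MatrixGroups Matrix ModularForm NNReal Classical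
open NumberField NumberField.mixedEmbedding IsDedekindDomain UpperHalfPlane

namespace Literature.NumberTheory.Automorphic

open GL2Real

/-! ### Linearity and injectivity of `f ↦ φ_f` -/

section Linear

variable (N : ℕ) (k : ℤ)

/-- `archLift k` is additive in `f`. [folklore] -/
theorem archLift_add (f g : ℍ → ℂ) : archLift k (f + g) = archLift k f + archLift k g := by
  funext x
  simp only [archLift_apply, SlashAction.add_slash, Pi.add_apply, add_mul]

/-- `archLift k` is homogeneous in `f` at matrices of positive determinant (at negative determinant
Mathlib's slash action is conjugate-linear, `UpperHalfPlane.σ`). [folklore] -/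
theorem archLift_smul_apply_of_det_pos (c : ℂ) (f : ℍ → ℂ) {x : GL (Fin 2) ℝ} (hx : 0 < x.det.val) :
    archLift k (c • f) x = c * archLift k f x := by
  have hσ : UpperHalfPlane.σ x c = c := by rw [UpperHalfPlane.σ, if_pos hx]; rfl
  rw [archLift_apply, archLift_apply, ModularForm.smul_slash, Pi.smul_apply, smul_eq_mul, hσ, mul_assoc]

/-- `f ↦ φ_f` is additive. [folklore] -/
theorem adelicLiftFun_add (f g : ℍ → ℂ) : adelicLiftFun N k (f + g) = adelicLiftFun N k f + adelicLiftFun N k g := by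
  funext x
  simp only [adelicLiftFun, archLift_add, Pi.add_apply]

/-- `f ↦ φ_f` is homogeneous (`φ_f` only evaluates `archLift` at positive determinant). [folklore] -/
theorem adelicLiftFun_smul (c : ℂ) (f : ℍ → ℂ) : adelicLiftFun N k (c • f) = c • adelicLiftFun N k f := by
  funext g
  simp only [adelicLiftFun, Pi.smul_apply, smul_eq_mul]
  exact archLift_smul_apply_of_det_pos k c f (Rat.mem_plusLevelOne_iff.1
    (Classical.choose_spec (Rat.exists_ofGlobal_inv_mul_mem_plusLevelOne (Ideal.span {(N : 𝓞 ℚ)}) g))).1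

/-- `f ↦ φ_f` respects subtraction. [folklore] -/
theorem adelicLiftFun_sub (f g : ℍ → ℂ) : adelicLiftFun N k (f - g) = adelicLiftFun N k f - adelicLiftFun N k g := by
  rw [sub_eq_add_neg, adelicLiftFun_add, ← neg_one_smul ℂ g, adelicLiftFun_smul, neg_one_smul, sub_eq_add_neg]

/-- `φ_0 = 0`. [folklore] -/
theorem adelicLiftFun_zero : adelicLiftFun N k (0 : ℍ → ℂ) = 0 := by
  rw [← zero_smul ℂ (0 : ℍ → ℂ), adelicLiftFun_smul, zero_smul]

variable {N k} [NeZero N]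

/-- **`f ↦ φ_f` is injective on `S_k(Γ₁(N))`** (`f` is recovered from `φ_f` on `GL₂(ℝ)⁺ × {1}`,
`archDescent_adelicLiftFun`). [cite: Gelbart1975, Prop. 3.1] -/
theorem adelicLiftFun_injective {f g : CuspForm (CongruenceSubgroup.Gamma1 N) k}
    (h : adelicLiftFun N k f = adelicLiftFun N k g) : f = g := by
  refine DFunLike.ext' ?_
  rw [← archDescent_adelicLiftFun (f := f), ← archDescent_adelicLiftFun (f := g), h]

/-- **Operator identities descend**: if `φ_g = c • φ_f` then `g = c • f`. [folklore] -/
theorem eq_smul_of_adelicLiftFun_eq_smul {f g : CuspForm (CongruenceSubgroup.Gamma1 N) k} {c : ℂ}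
    (h : adelicLiftFun N k g = c • adelicLiftFun N k f) : g = c • f := by
  refine adelicLiftFun_injective ?_
  rw [h, CuspForm.IsGLPos.coe_smul, adelicLiftFun_smul]

/-- The same for the typed alias `adelicLiftFunA`. [folklore] -/
theorem eq_smul_of_adelicLiftFunA_eq_smul {f g : CuspForm (CongruenceSubgroup.Gamma1 N) k} {c : ℂ}
    (h : adelicLiftFunA N k g = c • adelicLiftFunA N k f) : g = c • f :=
  eq_smul_of_adelicLiftFun_eq_smul h

end Linear

/-! ### The descent of a weight-one vector -/

section Descent

variable {hcpt : isCompact_glFiniteIntegralLevel 2 ℚ} {N : ℕ} [NeZero N]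

/-- Positive real scalars of `A_G` are `ι_𝔸` of the real scalar matrices. [folklore] -/
theorem Rat.posRealScalar_two_eq_iotaA (t : ℝ≥0ˣ) :
    (show (AdelicGroupData.gl 2 ℚ).Adelic from posRealScalar 2 ℚ t) =
      Rat.iotaA ⟨realScalarGL ((t : ℝ≥0) : ℝ) (NNReal.coe_pos.2 (pos_iff_ne_zero.2 t.ne_zero)), Subgroup.mem_top _⟩ := by
  have h := Rat.ofRealGL_archGL_mul_ofFinite_sndHom 2 (posRealScalar 2 ℚ t)
  rw [Rat.archGL_posRealScalar_two, Rat.sndHom_posRealScalar, map_one, mul_one] at h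
  exact h.symm

/-- **The descent of a weight-one vector** (Gelbart 1997, Prop. 2.5, converse, weight one): a cusp
form `ψ` on `GL₂(𝔸_ℚ)`, right invariant under `{1} × K₁(N)`, of weight one along `ι_𝔸`, with
`X ψ = 0` and `Z ψ = 0`, is the adelic lift of a classical cusp form `f_ψ ∈ S₁(Γ₁(N))`:
`φ_{f_ψ} = ψ`. [cite: Gelbart1997, Prop. 2.5] [cite: Bump1997, §3.6] -/
theorem exists_cuspForm_one_lift_eq (hb : AutomorphicRepsGL.cuspidal_bounded hcpt)
    {ψ : (AdelicGroupData.gl 2 ℚ).Adelic → ℂ} (hcusp : ψ ∈ cuspFormsGL 2 ℚ hcpt)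
    (hright : ∀ h ∈ gammaOneFiniteLevel ℚ (Ideal.span {(N : 𝓞 ℚ)}),
      ∀ g : GL (Fin 2) (AdeleRing (𝓞 ℚ) ℚ), ψ (g * GLn.ofFinite 2 ℚ h) = ψ g)
    (hw : IsWeightVec Rat.iotaA 1 ψ) (hL : lowerFun Rat.iotaA ψ = 0) (hZ : lieDeriv Rat.iotaA (toLie 1) ψ = 0) :
    ∃ f : CuspForm (CongruenceSubgroup.Gamma1 N) 1, adelicLiftFunA N 1 f = ψ := by
  have hauto : IsAutomorphicForm (AutomorphyDatum.gl 2 ℚ hcpt) ψ :=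
    isAutomorphicForm_of_mem_automorphicForms_gl (cuspFormsGL_le_automorphicForms 2 ℚ hcpt hcusp)
  have hs : IsArchSmooth Rat.iotaA ψ := hauto.archSmooth.iotaA
  -- (i) left invariance
  have hleft : ∀ (γ : GL (Fin 2) ℚ) (g : GL (Fin 2) (AdeleRing (𝓞 ℚ) ℚ)), ψ (GLn.ofGlobal 2 ℚ γ * g) = ψ g :=
    fun γ g => hauto.leftInvariant _ ⟨γ, rfl⟩ g
  -- the pull-back to `GL₂(ℝ)` is `y ↦ ψ (1 * ι_𝔸 y)`
  have hpull : (fun x : GL (Fin 2) ℝ => ψ (Rat.ofRealGL 2 x)) = fun y => ψ (1 * Rat.ofRealGLA y) := by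
    funext y; rw [one_mul]; rfl
  -- (iii)+(iv) weight one, (v) `X = 0`, smoothness
  have hweight : HasArchWeight 1 fun x : GL (Fin 2) ℝ => ψ (Rat.ofRealGL 2 x) := by
    rw [hpull]; exact hasArchWeight_one_of_isWeightVec hw hs hZ 1
  have hsmooth : IsArchSmooth incl fun x : GL (Fin 2) ℝ => ψ (Rat.ofRealGL 2 x) := by
    rw [hpull]; exact isArchSmooth_incl_of_inclOf hs 1
  have hlow : ∀ x : GL (Fin 2) ℝ, 0 < x.det.val → lowering (fun x : GL (Fin 2) ℝ => ψ (Rat.ofRealGL 2 x)) x = 0 := by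
    intro x _
    rw [hpull]; exact lowering_eq_zero_of_lowerFun_eq_zero hL 1 x
  -- boundedness: `ψ` is `A_G`-invariant (`Z ψ = 0`), hence bounded
  have hA : ∀ z ∈ (AdelicGroupData.gl 2 ℚ).center', ∀ g, ψ (z * g) = ψ g := by
    rintro _ ⟨t, rfl⟩ g
    have hc := Subgroup.mem_center_iff.1 (posRealScalar_mem_center 2 ℚ t) g
    change ψ ((show (AdelicGroupData.gl 2 ℚ).Adelic from posRealScalar 2 ℚ t) * g) = ψ g
    rw [show (show (AdelicGroupData.gl 2 ℚ).Adelic from posRealScalar 2 ℚ t) * g =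
        g * (show (AdelicGroupData.gl 2 ℚ).Adelic from posRealScalar 2 ℚ t) from hc.symm,
      Rat.posRealScalar_two_eq_iotaA]
    exact apply_mul_realScalarGL_of_lieDeriv_one hs hZ g (NNReal.coe_pos.2 (pos_iff_ne_zero.2 t.ne_zero))
  obtain ⟨C, hC⟩ := hb ψ hcusp hA
  have hbdd : ∃ C : ℝ, ∀ x : GL (Fin 2) ℝ, 0 < x.det.val → ‖ψ (Rat.ofRealGL 2 x)‖ ≤ C :=
    ⟨C, fun x _ => hC _⟩
  exact ⟨adelicDescentCuspForm N 1 one_pos ψ hleft hright hweight hsmooth hlow hbdd,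
    adelicLiftFun_adelicDescentCuspForm one_pos hleft hright hweight hsmooth hlow hbdd⟩

end Descent

end Literature.NumberTheory.Automorphic

end
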